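import Summits.Ventures.HodgeRepro2.T5SU11ResolventL2Sharp
import Summits.Ventures.HodgeRepro2.T5SU11ResolventNeumann

/-!
# The `L²` iterates, the `L²` Lipschitz bound and the `L²` Neumann series for every square-integrable source of the class

Rows 534, 537 and 540 control the iterates, the dependence on `μ` and the Neumann series of the resolvent in `L²(sinh 2t dt)`
for sources of the class at a rate `ε > 1`. With row 549's sharp bound `‖G^I_λ g‖₂ ≤ ‖g‖₂/(λ − 1)²` for every
square-integrable source of the class (rate `ε > 2 − λ` only) and row 503's class data of the iterates, the same holds for
every square-integrable source of the class:

* `iterate_l2_all` — **`sinh 2t ((G^I_λ)ⁿ g)² ∈ L¹` and `∫ sinh 2t ((G^I_λ)ⁿ g)² ≤ (∫ sinh 2t g²)/((λ − 1)⁴)ⁿ`** for every `n`;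
* `integral_sinh_mul_sub_sq_le_all` — **`‖G^I_λ g − G^I_{λ₂} g‖₂² ≤ (μ − μ₂)² ‖g‖₂²/((λ − 1)⁴ (λ₂ − 1)⁴)`** (row 500's resolvent
  identity, the sharp bound twice);
* `integral_sinh_mul_neumann_remainder_sq_le_all`, `tendsto_neumann_l2_all` — **the Neumann series
  `Σ (μ − μ₂)^k (G^I_{λ₂})^{k+1} g` converges to `G^I_λ g` in `L²` for `|μ − μ₂| < (λ₂ − 1)²`**, with the remainder
  `‖·‖₂² ≤ ((μ − μ₂)²/(λ₂ − 1)⁴)^{n+1} ‖g‖₂²/(λ − 1)⁴` — the disc `|μ − μ₂| < dist(μ₂, −1)`.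

Nothing is claimed about (N).

Blind lane: Mathlib + the HodgeRepro2 prefix only; no sorry; axioms ⊆ {propext, Classical.choice,
Quot.sound}.
-/

namespace Summit.Ventures.HodgeRepro2.T5SU11ResolventL2NeumannAll

open Filter Topology MeasureTheory
open Set (Ioi Ioc)
open T5SU11Cartan T5SU11SphericalFunction T5SU11SphericalDecay T5SU11RadialGreenImproper
  T5SU11RadialGreenImproperStable T5SU11ResolventIdentityDecay T5SU11ResolventNeumann T5SU11ResolventL2Sharp

section measure

variable [MeasurableSpace Circle] [BorelSpace Circle]

variable {lam : ℝ} (hlam : 1 < lam) {g : ℝ → ℝ} (hg : ContinuousOn g (Ioi 0))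
  {M : ℝ} (hM : ∀ s ∈ Ioc (0 : ℝ) 1, |g s| ≤ M) (hM0 : 0 ≤ M)
  {ε C s₀ : ℝ} (hε : 2 - lam < ε) (hC : ∀ s, s₀ ≤ s → |g s| ≤ C * Real.exp (-ε * s))
  (hg2 : IntegrableOn (fun s => Real.sinh (2 * s) * g s ^ 2) (Ioi 0))

include hlam hg hM hM0 hε hC hg2 in
/-- **THE `L²` ITERATES FOR EVERY SQUARE-INTEGRABLE SOURCE OF THE CLASS**: `sinh 2t ((G^I_λ)ⁿ g)²` is integrable and
`∫ sinh 2t ((G^I_λ)ⁿ g)² ≤ (∫ sinh 2t g²)/(((λ − 1)²)²)ⁿ` for every `n` (`λ > 1`). -/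
theorem iterate_l2_all (n : ℕ) :
    IntegrableOn (fun t => Real.sinh (2 * t) * ((greenSolI (fun t => sph lam (hyp t)) (sphDecay lam))^[n] g) t ^ 2)
      (Ioi 0) ∧
    ∫ t in Ioi 0, Real.sinh (2 * t) * ((greenSolI (fun t => sph lam (hyp t)) (sphDecay lam))^[n] g) t ^ 2
      ≤ (∫ t in Ioi 0, Real.sinh (2 * t) * g t ^ 2) / (((lam - 1) ^ 2) ^ 2) ^ n := by
  induction n with
  | zero => exact ⟨by simpa using hg2, by simp⟩
  | succ n ih =>
    obtain ⟨ihI, ihB⟩ := ih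
    -- the `n`-th iterate is in the class at a rate `ε′ ∈ (2 − λ, min(ε, λ))`
    have hmin : 2 - lam < min ε lam := lt_min hε (by linarith)
    obtain ⟨hcont, ⟨M', hM'0, hM'⟩, hdec⟩ := iterate_class (lam₂ := lam) hlam hg hM hM0 hε hC n
    obtain ⟨K, T, _, _, hKT⟩ := hdec ((2 - lam + min ε lam) / 2) (by linarith)
    have hε' : 2 - lam < (2 - lam + min ε lam) / 2 := by linarith
    have hp : 0 < ((lam - 1) ^ 2) ^ 2 := by
      have : 0 < lam - 1 := by linarith
      positivity
    rw [Function.iterate_succ_apply']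
    refine ⟨integrableOn_sinh_mul_greenSolI_sq_all hlam hcont hM' hM'0 hε' hKT ihI, ?_⟩
    calc ∫ t in Ioi 0, Real.sinh (2 * t) * greenSolI (fun t => sph lam (hyp t)) (sphDecay lam)
          ((greenSolI (fun t => sph lam (hyp t)) (sphDecay lam))^[n] g) t ^ 2
        ≤ (∫ t in Ioi 0, Real.sinh (2 * t) * ((greenSolI (fun t => sph lam (hyp t)) (sphDecay lam))^[n] g) t ^ 2)
            / ((lam - 1) ^ 2) ^ 2 :=
          integral_sinh_mul_greenSolI_sq_le_sharp hlam hcont hM' hM'0 hε' hKT ihI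
      _ ≤ ((∫ t in Ioi 0, Real.sinh (2 * t) * g t ^ 2) / (((lam - 1) ^ 2) ^ 2) ^ n) / ((lam - 1) ^ 2) ^ 2 :=
          div_le_div_of_nonneg_right ihB hp.le
      _ = (∫ t in Ioi 0, Real.sinh (2 * t) * g t ^ 2) / (((lam - 1) ^ 2) ^ 2) ^ (n + 1) := by
          rw [pow_succ (((lam - 1) ^ 2) ^ 2) n, div_div]

include hlam hg hM hM0 hε hC hg2 in
/-- **THE `L²` LIPSCHITZ BOUND IN `μ` FOR EVERY SQUARE-INTEGRABLE SOURCE OF THE CLASS**: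
`∫ sinh 2t (G^I_λ g − G^I_{λ₂} g)² ≤ (μ − μ₂)² (∫ sinh 2t g²)/(((λ − 1)²)² ((λ₂ − 1)²)²)` (`λ, λ₂ > 1`, rate
`ε > max(2 − λ, 2 − λ₂)`). -/
theorem integral_sinh_mul_sub_sq_le_all {lam₂ : ℝ} (hlam₂ : 1 < lam₂) (hε₂ : 2 - lam₂ < ε) :
    ∫ t in Ioi 0, Real.sinh (2 * t) * (greenSolI (fun t => sph lam (hyp t)) (sphDecay lam) g t
        - greenSolI (fun t => sph lam₂ (hyp t)) (sphDecay lam₂) g t) ^ 2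
      ≤ (lam * (lam - 2) - lam₂ * (lam₂ - 2)) ^ 2 * (∫ t in Ioi 0, Real.sinh (2 * t) * g t ^ 2)
          / (((lam - 1) ^ 2) ^ 2 * ((lam₂ - 1) ^ 2) ^ 2) := by
  set κ := lam * (lam - 2) - lam₂ * (lam₂ - 2) with hκ
  set h := greenSolI (fun t => sph lam₂ (hyp t)) (sphDecay lam₂) g with hh
  -- the class data and the `L²` membership of `h = G^I_{λ₂} g`
  have hcont := continuousOn_greenSolI hlam₂ hg hM hM0 hε₂ hC
  obtain ⟨M', hM'0, hM'⟩ := exists_abs_greenSolI_le_of_le_one hlam₂ hg hM hM0 hε₂ hC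
  have hmin : 2 - lam < min ε lam₂ := lt_min hε (by linarith)
  obtain ⟨K, T, _, _, hKT⟩ := exists_abs_greenSolI_le_exp hlam₂ hg hM hM0 hε₂ hC
    (ε' := (2 - lam + min ε lam₂) / 2) (by linarith)
  have hε' : 2 - lam < (2 - lam + min ε lam₂) / 2 := by linarith
  have hh2 := integrableOn_sinh_mul_greenSolI_sq_all hlam₂ hg hM hM0 hε₂ hC hg2
  -- the pointwise resolvent identity
  have e : (fun t => Real.sinh (2 * t) * (greenSolI (fun t => sph lam (hyp t)) (sphDecay lam) g t
        - greenSolI (fun t => sph lam₂ (hyp t)) (sphDecay lam₂) g t) ^ 2)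
      =ᵐ[volume.restrict (Ioi 0)] fun t => κ ^ 2
        * (Real.sinh (2 * t) * greenSolI (fun t => sph lam (hyp t)) (sphDecay lam) h t ^ 2) := by
    refine ae_restrict_of_forall_mem measurableSet_Ioi (fun t ht => ?_)
    have := greenSolI_sub_greenSolI_eq hlam hlam₂ hg hM hM0 hε hε₂ hC (t := t) ht
    beta_reduce
    rw [this]
    ring
  rw [MeasureTheory.integral_congr_ae e, MeasureTheory.integral_const_mul]
  have h1 := integral_sinh_mul_greenSolI_sq_le_sharp hlam hcont hM' hM'0 hε' hKT hh2
  have h2 := integral_sinh_mul_greenSolI_sq_le_sharp hlam₂ hg hM hM0 hε₂ hC hg2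
  have hp1 : 0 < ((lam - 1) ^ 2) ^ 2 := by
    have : 0 < lam - 1 := by linarith
    positivity
  calc κ ^ 2 * ∫ t in Ioi 0, Real.sinh (2 * t) * greenSolI (fun t => sph lam (hyp t)) (sphDecay lam) h t ^ 2
      ≤ κ ^ 2 * ((∫ t in Ioi 0, Real.sinh (2 * t) * h t ^ 2) / ((lam - 1) ^ 2) ^ 2) :=
        mul_le_mul_of_nonneg_left h1 (sq_nonneg _)
    _ ≤ κ ^ 2 * (((∫ t in Ioi 0, Real.sinh (2 * t) * g t ^ 2) / ((lam₂ - 1) ^ 2) ^ 2) / ((lam - 1) ^ 2) ^ 2) :=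
        mul_le_mul_of_nonneg_left (div_le_div_of_nonneg_right h2 hp1.le) (sq_nonneg _)
    _ = κ ^ 2 * (∫ t in Ioi 0, Real.sinh (2 * t) * g t ^ 2) / (((lam - 1) ^ 2) ^ 2 * ((lam₂ - 1) ^ 2) ^ 2) := by
        rw [div_div, mul_comm (((lam₂ - 1) ^ 2) ^ 2), mul_div_assoc]

include hlam hg hM hM0 hε hC hg2 in
/-- **THE `L²` BOUND OF THE NEUMANN REMAINDER FOR EVERY SQUARE-INTEGRABLE SOURCE OF THE CLASS**:
`‖G^I_λ g − Σ_{k=0}^{n} (μ − μ₂)^k (G^I_{λ₂})^{k+1} g‖₂² ≤ ((μ − μ₂)²/((λ₂ − 1)²)²)^{n+1} ‖g‖₂²/((λ − 1)²)²`. -/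
theorem integral_sinh_mul_neumann_remainder_sq_le_all {lam₂ : ℝ} (hlam₂ : 1 < lam₂) (hε₂ : 2 - lam₂ < ε) (n : ℕ) :
    ∫ t in Ioi 0, Real.sinh (2 * t) * (greenSolI (fun t => sph lam (hyp t)) (sphDecay lam) g t
        - ∑ k ∈ Finset.range (n + 1), (lam * (lam - 2) - lam₂ * (lam₂ - 2)) ^ k
          * (greenSolI (fun t => sph lam₂ (hyp t)) (sphDecay lam₂))^[k + 1] g t) ^ 2
      ≤ ((lam * (lam - 2) - lam₂ * (lam₂ - 2)) ^ 2 / ((lam₂ - 1) ^ 2) ^ 2) ^ (n + 1)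
          * ((∫ t in Ioi 0, Real.sinh (2 * t) * g t ^ 2) / ((lam - 1) ^ 2) ^ 2) := by
  set κ := lam * (lam - 2) - lam₂ * (lam₂ - 2) with hκ
  set h := (greenSolI (fun t => sph lam₂ (hyp t)) (sphDecay lam₂))^[n + 1] g with hh
  -- `h` is in the class at a rate `ε′ ∈ (2 − λ, min(ε, λ₂))`, and in `L²`
  have hmin : 2 - lam < min ε lam₂ := lt_min hε (by linarith)
  obtain ⟨hcont, ⟨M', hM'0, hM'⟩, hdec⟩ := iterate_class hlam₂ hg hM hM0 hε₂ hC (n + 1)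
  obtain ⟨K, T, _, _, hKT⟩ := hdec ((2 - lam + min ε lam₂) / 2) (by linarith)
  have hε' : 2 - lam < (2 - lam + min ε lam₂) / 2 := by linarith
  obtain ⟨hh2, hhB⟩ := iterate_l2_all hlam₂ hg hM hM0 hε₂ hC hg2 (n + 1)
  -- the pointwise remainder identity
  have e : (fun t => Real.sinh (2 * t) * (greenSolI (fun t => sph lam (hyp t)) (sphDecay lam) g t
        - ∑ k ∈ Finset.range (n + 1), κ ^ k * (greenSolI (fun t => sph lam₂ (hyp t)) (sphDecay lam₂))^[k + 1] g t) ^ 2)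
      =ᵐ[volume.restrict (Ioi 0)] fun t => (κ ^ (n + 1)) ^ 2
        * (Real.sinh (2 * t) * greenSolI (fun t => sph lam (hyp t)) (sphDecay lam) h t ^ 2) := by
    refine ae_restrict_of_forall_mem measurableSet_Ioi (fun t ht => ?_)
    have := neumann_finite hlam hlam₂ hg hM hM0 hε hε₂ hC n (t := t) ht
    beta_reduce
    rw [this]
    ring
  rw [MeasureTheory.integral_congr_ae e, MeasureTheory.integral_const_mul]
  have h1 := integral_sinh_mul_greenSolI_sq_le_sharp hlam hcont hM' hM'0 hε' hKT hh2
  have hp1 : 0 < ((lam - 1) ^ 2) ^ 2 := by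
    have : 0 < lam - 1 := by linarith
    positivity
  have hp2 : 0 < (((lam₂ - 1) ^ 2) ^ 2) ^ (n + 1) := by
    have : 0 < lam₂ - 1 := by linarith
    positivity
  calc (κ ^ (n + 1)) ^ 2 * ∫ t in Ioi 0, Real.sinh (2 * t) * greenSolI (fun t => sph lam (hyp t)) (sphDecay lam) h t ^ 2
      ≤ (κ ^ (n + 1)) ^ 2 * ((∫ t in Ioi 0, Real.sinh (2 * t) * h t ^ 2) / ((lam - 1) ^ 2) ^ 2) :=
        mul_le_mul_of_nonneg_left h1 (sq_nonneg _)
    _ ≤ (κ ^ (n + 1)) ^ 2 * (((∫ t in Ioi 0, Real.sinh (2 * t) * g t ^ 2) / (((lam₂ - 1) ^ 2) ^ 2) ^ (n + 1))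
          / ((lam - 1) ^ 2) ^ 2) :=
        mul_le_mul_of_nonneg_left (div_le_div_of_nonneg_right hhB hp1.le) (sq_nonneg _)
    _ = (κ ^ 2 / ((lam₂ - 1) ^ 2) ^ 2) ^ (n + 1) * ((∫ t in Ioi 0, Real.sinh (2 * t) * g t ^ 2) / ((lam - 1) ^ 2) ^ 2) := by
        have ha : ((lam - 1) ^ 2) ^ 2 ≠ 0 := hp1.ne'
        have hb : (((lam₂ - 1) ^ 2) ^ 2) ^ (n + 1) ≠ 0 := hp2.ne'
        rw [div_pow]
        field_simp
        ring

include hlam hg hM hM0 hε hC hg2 in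
/-- **THE NEUMANN SERIES CONVERGES IN `L²` FOR EVERY SQUARE-INTEGRABLE SOURCE OF THE CLASS** on `|μ − μ₂| < (λ₂ − 1)²`:
`‖G^I_λ g − Σ_{k=0}^{n} (μ − μ₂)^k (G^I_{λ₂})^{k+1} g‖₂² → 0`. -/
theorem tendsto_neumann_l2_all {lam₂ : ℝ} (hlam₂ : 1 < lam₂) (hε₂ : 2 - lam₂ < ε)
    (hq : |lam * (lam - 2) - lam₂ * (lam₂ - 2)| < (lam₂ - 1) ^ 2) :
    Tendsto (fun n : ℕ => ∫ t in Ioi 0, Real.sinh (2 * t) * (greenSolI (fun t => sph lam (hyp t)) (sphDecay lam) g t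
        - ∑ k ∈ Finset.range (n + 1), (lam * (lam - 2) - lam₂ * (lam₂ - 2)) ^ k
          * (greenSolI (fun t => sph lam₂ (hyp t)) (sphDecay lam₂))^[k + 1] g t) ^ 2) atTop (𝓝 0) := by
  set κ := lam * (lam - 2) - lam₂ * (lam₂ - 2) with hκ
  set q := κ ^ 2 / ((lam₂ - 1) ^ 2) ^ 2 with hq_def
  have hb : 0 < ((lam₂ - 1) ^ 2) ^ 2 := by
    have : 0 < lam₂ - 1 := by linarith
    positivity
  have hq0 : 0 ≤ q := by positivity
  have hq1 : q < 1 := by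
    rw [hq_def, div_lt_one hb]
    have := pow_lt_pow_left₀ hq (abs_nonneg _) two_ne_zero
    rwa [sq_abs] at this
  set Kc := (∫ t in Ioi 0, Real.sinh (2 * t) * g t ^ 2) / ((lam - 1) ^ 2) ^ 2 with hKc
  have hlim : Tendsto (fun n : ℕ => q ^ (n + 1) * Kc) atTop (𝓝 0) := by
    have h := ((tendsto_pow_atTop_nhds_zero_of_lt_one hq0 hq1).comp (tendsto_add_atTop_nat 1)).mul_const Kc
    rwa [zero_mul] at h
  refine squeeze_zero (fun n => ?_)
    (fun n => integral_sinh_mul_neumann_remainder_sq_le_all hlam hg hM hM0 hε hC hg2 hlam₂ hε₂ n) hlim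
  apply setIntegral_nonneg measurableSet_Ioi
  intro t ht
  have ht0 : 0 < t := ht
  exact mul_nonneg (Real.sinh_nonneg_iff.mpr (by linarith)) (sq_nonneg _)

end measure

end Summit.Ventures.HodgeRepro2.T5SU11ResolventL2NeumannAll
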